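import Literature.MathematicalPhysics.QuantumFieldTheory.Balaban1983to89.B5GaussSectCR144

/-! # `Balaban1983to89.B5Projector144Exists` — B5 p. 25: «Now all the operators appearing in these formulas are
well defined»: EXISTENCE of Δ⁻¹ and (Q′_kΔ⁻²Q′_k*)⁻¹ (p. 22), of G′_k = (Δ + aQ′_k*Q′_k)⁻¹ and of (Q′_kG′_k²Q′_k*)⁻¹
(p. 25) in finite dimension from the printed structural facts, i.e. reader A's hypothesis bundles `LapData` /
`GreenData` / `hci` of `B5Projector144` are INHABITED by constructed operators (unit b2b-balaban-b05-g13, node 6)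

CITATION HEADER. T. Bałaban, *Propagators and renormalization transformations for lattice gauge theories. I*,
Commun. Math. Phys. 95 (1984) 17–40 [`Balaban1984PropagatorsI`], Sect. C, p. 22 [PDF 6] and p. 25 [PDF 9]
(render `…/1984-cmp95-propagators-rt-I-p009-x2.png` READ AS AN IMAGE by this unit; p. 22 as transcribed in the
header of `B5Projector144`). Cell pub-balaban, paper sub-cell B05.

WHAT IS PRINTED.  p. 22 [PDF 6] (transcription of `B5Projector144`): «the Laplace operator Δ on the torus T_η … is a
symmetric, non-negative operator, and 0 is its eigenvalue. Constant functions form the eigenspace corresponding to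
the eigenvalue 0, and on the subspace orthogonal to constant functions the operator Δ is positive. Hence it is an
invertible operator and by Δ⁻¹ we denote its inverse on this subspace. We extend it to the whole space by linearity,
putting its value on constant functions equal to 0. Let us notice further that the operator Q′_k transforms constant
functions on the η-lattice into constant functions on the unit lattice, and similarly for the orthogonal subspaces.
This implies the corresponding property for Q′_k*».  p. 25 [PDF 9] ll. 28–31: «with a > 0 (we will take eventually
a = 1), and let us denote Δ′_a = Δ + aQ′_k*Q′_k = Δ + aP′_k. The properties of this operator were investigated in
[2], its inverse is a bounded operator G′_k with good regularity properties described in Theorem of [2].»;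
ll. 36–41 (after (1.44)): «Now all the operators appearing in these formulas are well defined. We have to verify it
only for (Q′_kG′_k²Q′_k*)⁻¹. It is enough to prove that Q′_kG′_k²Q′_k* is positive definite. This operator is of
course nonnegative and if for some ω defined on T₁^(k) we have ⟨ω, Q′_kG′_k²Q′_k*ω⟩ = ‖G′_kQ′_k*ω‖² = 0, then
Q′_k*ω = 0, hence ω = 0. We have bounds 0 < Q′_kG′_k²Q′_k* ≤ a⁻², and they imply the existence of the inverse
operator and a bound from below.»

TYPING (that of `B5Projector144`: abstract real inner-product spaces `E` = L²(T_η), `F` = functions on T₁^(k),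
`one`/`one'` the constants, `Δ`, `q` = Q′_k, `qs` = Q′_k*, `a`; here `E`, `F` FINITE-DIMENSIONAL, as they are in
print — T_η and T₁^(k) are finite tori).  The printed STRUCTURAL FACTS enter as the hypotheses
`hΔs` (Δ symmetric), `hpos : ∀ x, 0 ≤ ⟨Δx, x⟩` («non-negative»), `hposK : ⟨1, x⟩ = 0 → x ≠ 0 → 0 < ⟨Δx, x⟩`
(«on the subspace orthogonal to constant functions the operator Δ is positive») or the equivalent working form
`hker : ⟨Δx, x⟩ = 0 → π₁x = x` (`proj1_eq_self_of_form_eq_zero`: the null vectors of the form are the constants),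
`h1 : Δ1 = 0` («Constant functions form the eigenspace corresponding to the eigenvalue 0»), `hadj` (Q′_k* adjoint to
Q′_k), `hq1 : Q′_k1 = 1′`, `hperp` (Q′_k(1^⊥) ⊆ 1′^⊥, «similarly for the orthogonal subspaces»), `hone' : 1′ ≠ 0`,
`hqs : Q′_k* injective` (the printed step «Q′_k*ω = 0, hence ω = 0»; for the block averages (1.20) it holds because
Q′_kQ′_k* = I), `ha : 0 < a` («with a > 0»).

WHAT THIS FILE CERTIFIES (kernel, no `sorry`; value = the existence half of GAPS G-B5-13 / the «well defined»
paragraph of p. 25, so that `B5Projector144`'s bundles and hence `B5GaussSectCR144.Rop_eq_R144` hold for CONSTRUCTED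
operators under the printed structural facts alone; NOT summit progress).
1. §1 `lapPrime_injective`: Δ′_a = Δ + aQ′_k*Q′_k is injective — ⟨Δ′_ax, x⟩ = ⟨Δx, x⟩ + a‖Q′_kx‖², so Δ′_ax = 0 forces
   x constant and Q′_kx = 0, hence x = 0; `green` := its inverse G′_k (Mathlib `LinearEquiv.ofInjectiveEndo`, finite
   dimension), `green_left`/`green_right` (G′_kΔ′_a = Δ′_aG′_k = I), `green_symm`.
2. §2 THE PRINTED ARGUMENT VERBATIM: `inner_qggq` ⟨ω, Q′_kG′_k²Q′_k*ω⟩ = ‖G′_kQ′_k*ω‖²; `qggq_nonneg` («of course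
   nonnegative»); `qggq_injective`/`qggq_pos` («if … = 0, then Q′_k*ω = 0, hence ω = 0»; 0 < Q′_kG′_k²Q′_k*);
   `cinv` := (Q′_kG′_k²Q′_k*)⁻¹ with `cinv_left`/`cinv_right`; `greenData` : `GreenData Δ q qs a green cinv`, and
   `exists_greenData` from the structural facts alone.
3. §3 p. 22: `lapInv` := Δ⁻¹ («its inverse on this subspace … putting its value on constant functions equal to 0»:
   the inverse of Δ↾(1^⊥) composed with the orthogonal projection onto 1^⊥), `lapData` : `LapData one Δ lapInv`
   (ΔΔ⁻¹ = Δ⁻¹Δ = I − π₁, Δ⁻¹1 = 0), `exists_lapData` from `hΔs`, `h1`, `hker`, 1 ≠ 0.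
4. §4 `avgData_adjoint`: with Q′_k* := the adjoint (`LinearMap.adjoint q`) the bundle `AvgData` holds given Q′_k1 = 1′
   and the p. 22 orthogonality clause; `qs_eq_adjoint`: any `qs` satisfying `hadj` IS that adjoint.
5. §5 `Rop_eq_R144_constructed` / `exists_green_Rop_eq_R144`: the orthogonal projection onto ΔN(Q′_k) equals the
   printed (1.44) built from the CONSTRUCTED G′_k and (Q′_kG′_k²Q′_k*)⁻¹ (by `B5GaussSectCR144.Rop_eq_R144`).
6. §6 p. 22 «The operator Δ⁻² is positive on the subspace orthogonal to constant functions, hence Q′_kΔ⁻²Q′_k* is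
   positive also on the corresponding subspace on the unit lattice»: `inner_qiiq`, `qiiq_pos`, `qiiqK_injective`;
   `cinv138` := (Q′_kΔ⁻²Q′_k*)⁻¹ on 1′^⊥ CONSTRUCTED, `cinv138_spec` = reader A's clause `hci`, `exists_ci`.
7. §7 `exists_all_printed`: from the printed structural facts ALL of reader A's hypotheses (`LapData`, `AvgData`,
   `GreenData`, `hci`) hold SIMULTANEOUSLY for constructed operators (a non-degenerate complement to
   `B5Projector144.hypotheses_satisfiable`), whence R⊥ = (1.44) on L²(T_η) and = (1.38) on 1^⊥.

NOT CERTIFIED: the upper bound «Q′_kG′_k²Q′_k* ≤ a⁻²» (GAPS G-B5-13: an objection row of the cell — false for large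
a; not needed for existence, and it does not follow from the structural facts above); «bounded … good regularity
properties described in Theorem of [2]» (quantitative, [2] = B4); no torus instantiation (the structural facts for
the b05 chain's `LapS`/`QsOp` of `B5GaussSectC` §7 are not derived here).

TAGS: [cite: Balaban1984PropagatorsI, p.25] / [cite: …, p.22] on the statements matching the printed sentences;
[folklore] on finite-dimensional linear algebra. -/

noncomputable section

open Module
open scoped InnerProductSpace

open Literature.MathematicalPhysics.QuantumFieldTheory.Balaban1983to89.B5Projector144
open Literature.MathematicalPhysics.QuantumFieldTheory.Balaban1983to89.B5GaussSectC (Rop)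
open Literature.MathematicalPhysics.QuantumFieldTheory.Balaban1983to89.B5GaussSectCR144 (Rop_eq_R144
  Rop_eq_R138_of_orth)

namespace Literature.MathematicalPhysics.QuantumFieldTheory.Balaban1983to89.B5Projector144Exists

variable {E F : Type*} [NormedAddCommGroup E] [InnerProductSpace ℝ E] [NormedAddCommGroup F]
  [InnerProductSpace ℝ F]
variable {one : E} {one' : F} {Δ : E →ₗ[ℝ] E} {q : E →ₗ[ℝ] F} {qs : F →ₗ[ℝ] E} {a : ℝ}

/-! ## §1 Δ′_a = Δ + aQ′_k*Q′_k is invertible: the operator G′_k -/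

/-- «let us denote Δ′_a = Δ + aQ′_k*Q′_k … its inverse is a bounded operator G′_k»: Δ′_a is INJECTIVE (hence, in
finite dimension, invertible) — ⟨Δ′_ax, x⟩ = ⟨Δx, x⟩ + a‖Q′_kx‖² with both terms ≥ 0, so Δ′_ax = 0 forces
⟨Δx, x⟩ = 0 (x is a constant, p. 22) and Q′_kx = 0 (the constant is 0, as Q′_k1 = 1′ ≠ 0).
[cite: Balaban1984PropagatorsI, p.25] -/
theorem lapPrime_injective (hpos : ∀ x : E, 0 ≤ inner ℝ (Δ x) x)
    (hker : ∀ x : E, inner ℝ (Δ x) x = 0 → proj1 one x = x)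
    (hadj : ∀ (x : E) (φ : F), inner ℝ (q x) φ = inner ℝ x (qs φ)) (hq1 : q one = one')
    (hone' : one' ≠ 0) (ha : 0 < a) : Function.Injective (lapPrime Δ q qs a) := by
  rw [injective_iff_map_eq_zero]
  intro x hx
  have hq : inner ℝ x (qs (q x)) = ‖q x‖ ^ 2 := by rw [← hadj, real_inner_self_eq_norm_sq]
  have h0 : inner ℝ (Δ x + a • qs (q x)) x = 0 := by rw [← lapPrime_apply, hx, inner_zero_left]
  rw [inner_add_left, real_inner_smul_left, ← real_inner_comm (qs (q x)) x, hq] at h0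
  have hΔ0 : inner ℝ (Δ x) x = 0 :=
    le_antisymm (by linarith [mul_nonneg ha.le (sq_nonneg ‖q x‖)]) (hpos x)
  have h2 : ‖q x‖ ^ 2 = 0 := by
    have h3 : a * ‖q x‖ ^ 2 = 0 := by linarith [hpos x]
    exact (mul_eq_zero.mp h3).resolve_left ha.ne'
  have hqx : q x = 0 := norm_eq_zero.mp ((pow_eq_zero_iff two_ne_zero).mp h2)
  have hx1 : proj1 one x = x := hker x hΔ0
  rw [proj1_apply] at hx1
  have ht : (inner ℝ one x / inner ℝ one one) • one' = 0 := by
    have h := congrArg q hx1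
    rw [map_smul, hq1, hqx] at h
    exact h
  rcases smul_eq_zero.mp ht with ht0 | h1'
  · rw [← hx1, ht0, zero_smul]
  · exact absurd h1' hone'

variable [FiniteDimensional ℝ E]

/-- G′_k := (Δ′_a)⁻¹ = (Δ + aQ′_k*Q′_k)⁻¹, CONSTRUCTED as the inverse of the injective endomorphism Δ′_a of the
finite-dimensional L²(T_η). [cite: Balaban1984PropagatorsI, p.25] -/
def green (h : Function.Injective (lapPrime Δ q qs a)) : E →ₗ[ℝ] E :=
  (LinearEquiv.ofInjectiveEndo (lapPrime Δ q qs a) h).symm.toLinearMap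

/-- G′_kΔ′_a = I. [folklore] -/
theorem green_lapPrime (h : Function.Injective (lapPrime Δ q qs a)) (x : E) :
    green h (lapPrime Δ q qs a x) = x :=
  (LinearEquiv.ofInjectiveEndo _ h).symm_apply_apply x

/-- Δ′_aG′_k = I. [folklore] -/
theorem lapPrime_green (h : Function.Injective (lapPrime Δ q qs a)) (x : E) :
    lapPrime Δ q qs a (green h x) = x :=
  (LinearEquiv.ofInjectiveEndo _ h).apply_symm_apply x

/-- `GreenData.g_left` for the constructed G′_k: G′_k(Δx + aQ′_k*Q′_kx) = x. [folklore] -/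
theorem green_left (h : Function.Injective (lapPrime Δ q qs a)) (x : E) :
    green h (Δ x + a • qs (q x)) = x := by
  rw [← lapPrime_apply]; exact green_lapPrime h x

/-- `GreenData.g_right` for the constructed G′_k: ΔG′_kx + aQ′_k*Q′_kG′_kx = x. [folklore] -/
theorem green_right (h : Function.Injective (lapPrime Δ q qs a)) (x : E) :
    Δ (green h x) + a • qs (q (green h x)) = x := by
  rw [← lapPrime_apply]; exact lapPrime_green h x

/-- G′_k is symmetric (inverse of the symmetric Δ′_a). [folklore] -/
theorem green_symm (h : Function.Injective (lapPrime Δ q qs a))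
    (hΔs : ∀ x y : E, inner ℝ (Δ x) y = inner ℝ x (Δ y))
    (hadj : ∀ (x : E) (φ : F), inner ℝ (q x) φ = inner ℝ x (qs φ)) (x y : E) :
    inner ℝ (green h x) y = inner ℝ x (green h y) := by
  calc inner ℝ (green h x) y = inner ℝ (green h x) (Δ (green h y) + a • qs (q (green h y))) := by
        rw [green_right]
    _ = inner ℝ (Δ (green h x)) (green h y) + a * inner ℝ (q (green h x)) (q (green h y)) := by
        rw [inner_add_right, ← hΔs, real_inner_smul_right, ← hadj]
    _ = inner ℝ (Δ (green h x) + a • qs (q (green h x))) (green h y) := by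
        rw [inner_add_left, real_inner_smul_left, adj_symm hadj]
    _ = inner ℝ x (green h y) := by rw [green_right]

/-- G′_kQ′_k*ω = 0 forces Q′_k*ω = 0 (apply Δ′_a). [folklore] -/
theorem qs_eq_zero_of_green (h : Function.Injective (lapPrime Δ q qs a)) {φ : F}
    (h0 : green h (qs φ) = 0) : qs φ = 0 := by
  have h' := green_right h (qs φ)
  rw [h0, map_zero, map_zero, map_zero, smul_zero, zero_add] at h'
  exact h'.symm

/-! ## §2 «It is enough to prove that Q′_kG′_k²Q′_k* is positive definite»: the operator (Q′_kG′_k²Q′_k*)⁻¹ -/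

/-- The operator Q′_kG′_k²Q′_k* on functions on T₁^(k), for the constructed G′_k.
[cite: Balaban1984PropagatorsI, p.25] -/
def qggq (h : Function.Injective (lapPrime Δ q qs a)) : F →ₗ[ℝ] F :=
  q ∘ₗ green h ∘ₗ green h ∘ₗ qs

/-- Unfolding of `qggq`. [folklore] -/
theorem qggq_apply (h : Function.Injective (lapPrime Δ q qs a)) (φ : F) :
    qggq h φ = q (green h (green h (qs φ))) := rfl

/-- «⟨ω, Q′_kG′_k²Q′_k*ω⟩ = ‖G′_kQ′_k*ω‖²». [cite: Balaban1984PropagatorsI, p.25] -/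
theorem inner_qggq (h : Function.Injective (lapPrime Δ q qs a))
    (hΔs : ∀ x y : E, inner ℝ (Δ x) y = inner ℝ x (Δ y))
    (hadj : ∀ (x : E) (φ : F), inner ℝ (q x) φ = inner ℝ x (qs φ)) (φ : F) :
    inner ℝ (qggq h φ) φ = ‖green h (qs φ)‖ ^ 2 := by
  rw [qggq_apply, hadj, green_symm h hΔs hadj, real_inner_self_eq_norm_sq]

/-- «This operator is of course nonnegative». [cite: Balaban1984PropagatorsI, p.25] -/
theorem qggq_nonneg (h : Function.Injective (lapPrime Δ q qs a))
    (hΔs : ∀ x y : E, inner ℝ (Δ x) y = inner ℝ x (Δ y))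
    (hadj : ∀ (x : E) (φ : F), inner ℝ (q x) φ = inner ℝ x (qs φ)) (φ : F) :
    0 ≤ inner ℝ (qggq h φ) φ := by
  rw [inner_qggq h hΔs hadj]; positivity

/-- «if for some ω defined on T₁^(k) we have ⟨ω, Q′_kG′_k²Q′_k*ω⟩ = ‖G′_kQ′_k*ω‖² = 0, then Q′_k*ω = 0, hence ω = 0»:
Q′_kG′_k²Q′_k* is INJECTIVE (Q′_k* injective). [cite: Balaban1984PropagatorsI, p.25] -/
theorem qggq_injective (h : Function.Injective (lapPrime Δ q qs a))
    (hΔs : ∀ x y : E, inner ℝ (Δ x) y = inner ℝ x (Δ y))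
    (hadj : ∀ (x : E) (φ : F), inner ℝ (q x) φ = inner ℝ x (qs φ)) (hqs : Function.Injective qs) :
    Function.Injective (qggq h) := by
  rw [injective_iff_map_eq_zero]
  intro φ hφ
  have h0 : ‖green h (qs φ)‖ ^ 2 = 0 := by rw [← inner_qggq h hΔs hadj φ, hφ, inner_zero_left]
  have h1 : green h (qs φ) = 0 := norm_eq_zero.mp ((pow_eq_zero_iff two_ne_zero).mp h0)
  have h2 : qs φ = 0 := qs_eq_zero_of_green h h1
  exact hqs (by rw [h2, map_zero])

/-- «0 < Q′_kG′_k²Q′_k*»: strictly positive on ω ≠ 0. [cite: Balaban1984PropagatorsI, p.25] -/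
theorem qggq_pos (h : Function.Injective (lapPrime Δ q qs a))
    (hΔs : ∀ x y : E, inner ℝ (Δ x) y = inner ℝ x (Δ y))
    (hadj : ∀ (x : E) (φ : F), inner ℝ (q x) φ = inner ℝ x (qs φ)) (hqs : Function.Injective qs)
    {φ : F} (hφ : φ ≠ 0) : 0 < inner ℝ (qggq h φ) φ := by
  rw [inner_qggq h hΔs hadj]
  have hne : green h (qs φ) ≠ 0 := fun h1 => hφ (hqs (by rw [qs_eq_zero_of_green h h1, map_zero]))
  exact pow_pos (norm_pos_iff.mpr hne) 2

variable [FiniteDimensional ℝ F]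

/-- (Q′_kG′_k²Q′_k*)⁻¹, CONSTRUCTED as the inverse of the injective endomorphism Q′_kG′_k²Q′_k* of the
finite-dimensional space of functions on T₁^(k) («they imply the existence of the inverse operator»).
[cite: Balaban1984PropagatorsI, p.25] -/
def cinv (h : Function.Injective (lapPrime Δ q qs a)) (hc : Function.Injective (qggq h)) : F →ₗ[ℝ] F :=
  (LinearEquiv.ofInjectiveEndo (qggq h) hc).symm.toLinearMap

/-- `GreenData.c_left` for the constructed inverse: (Q′_kG′_k²Q′_k*)⁻¹(Q′_kG′_k²Q′_k*φ) = φ. [folklore] -/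
theorem cinv_left (h : Function.Injective (lapPrime Δ q qs a)) (hc : Function.Injective (qggq h)) (φ : F) :
    cinv h hc (q (green h (green h (qs φ)))) = φ :=
  (LinearEquiv.ofInjectiveEndo _ hc).symm_apply_apply φ

/-- `GreenData.c_right` for the constructed inverse: Q′_kG′_k²Q′_k*((Q′_kG′_k²Q′_k*)⁻¹φ) = φ. [folklore] -/
theorem cinv_right (h : Function.Injective (lapPrime Δ q qs a)) (hc : Function.Injective (qggq h)) (φ : F) :
    q (green h (green h (qs (cinv h hc φ)))) = φ :=
  (LinearEquiv.ofInjectiveEndo _ hc).apply_symm_apply φ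

/-- **Reader A's `GreenData` is INHABITED by the constructed G′_k and (Q′_kG′_k²Q′_k*)⁻¹.**
[cite: Balaban1984PropagatorsI, p.25] -/
theorem greenData (h : Function.Injective (lapPrime Δ q qs a)) (hc : Function.Injective (qggq h)) :
    GreenData Δ q qs a (green h) (cinv h hc) :=
  ⟨green_left h, green_right h, cinv_left h hc, cinv_right h hc⟩

/-- **«Now all the operators appearing in these formulas are well defined»** — from the printed structural facts
alone (Δ symmetric, non-negative, null vectors = constants; Q′_k* adjoint to Q′_k, Q′_k1 = 1′ ≠ 0, Q′_k* injective;
a > 0) there EXIST G′_k and (Q′_kG′_k²Q′_k*)⁻¹ with all four identities of `GreenData`.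
[cite: Balaban1984PropagatorsI, p.25] -/
theorem exists_greenData (hpos : ∀ x : E, 0 ≤ inner ℝ (Δ x) x)
    (hker : ∀ x : E, inner ℝ (Δ x) x = 0 → proj1 one x = x)
    (hΔs : ∀ x y : E, inner ℝ (Δ x) y = inner ℝ x (Δ y))
    (hadj : ∀ (x : E) (φ : F), inner ℝ (q x) φ = inner ℝ x (qs φ)) (hq1 : q one = one')
    (hone' : one' ≠ 0) (hqs : Function.Injective qs) (ha : 0 < a) :
    ∃ (g : E →ₗ[ℝ] E) (c₂ : F →ₗ[ℝ] F), GreenData Δ q qs a g c₂ :=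
  have h := lapPrime_injective hpos hker hadj hq1 hone' ha
  ⟨green h, cinv h (qggq_injective h hΔs hadj hqs), greenData h _⟩

/-! ## §3 p. 22: the operator Δ⁻¹ («its inverse on this subspace … on constant functions equal to 0») -/

omit [FiniteDimensional ℝ E] [FiniteDimensional ℝ F] in
/-- Ran Δ ⊆ 1^⊥ (Δ symmetric, Δ1 = 0). [folklore] -/
theorem lap_mem_orth (hΔs : ∀ x y : E, inner ℝ (Δ x) y = inner ℝ x (Δ y)) (h1 : Δ one = 0) (x : E) :
    Δ x ∈ (ℝ ∙ one)ᗮ := by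
  rw [Submodule.mem_orthogonal_singleton_iff_inner_right, ← hΔs, h1, inner_zero_left]

omit [FiniteDimensional ℝ E] [FiniteDimensional ℝ F] in
/-- Δ restricted to the subspace 1^⊥ orthogonal to the constants, as an endomorphism of 1^⊥. [folklore] -/
def lapK (hΔs : ∀ x y : E, inner ℝ (Δ x) y = inner ℝ x (Δ y)) (h1 : Δ one = 0) :
    (ℝ ∙ one)ᗮ →ₗ[ℝ] (ℝ ∙ one)ᗮ :=
  LinearMap.codRestrict ((ℝ ∙ one)ᗮ) (Δ.domRestrict ((ℝ ∙ one)ᗮ)) fun x => lap_mem_orth hΔs h1 x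

omit [FiniteDimensional ℝ E] [FiniteDimensional ℝ F] in
/-- Unfolding of `lapK`. [folklore] -/
theorem coe_lapK_apply (hΔs : ∀ x y : E, inner ℝ (Δ x) y = inner ℝ x (Δ y)) (h1 : Δ one = 0)
    (x : (ℝ ∙ one)ᗮ) : (lapK hΔs h1 x : E) = Δ x := rfl

omit [FiniteDimensional ℝ E] [FiniteDimensional ℝ F] in
/-- «on the subspace orthogonal to constant functions the operator Δ is positive. Hence it is an invertible
operator»: Δ↾(1^⊥) is INJECTIVE when the null vectors of ⟨Δ·, ·⟩ are the constants.
[cite: Balaban1984PropagatorsI, p.22] -/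
theorem lapK_injective (hΔs : ∀ x y : E, inner ℝ (Δ x) y = inner ℝ x (Δ y)) (h1 : Δ one = 0)
    (hker : ∀ x : E, inner ℝ (Δ x) x = 0 → proj1 one x = x) : Function.Injective (lapK hΔs h1) := by
  rw [injective_iff_map_eq_zero]
  intro x hx
  have hx0 : Δ (x : E) = 0 := by rw [← coe_lapK_apply hΔs h1 x, hx]; rfl
  have hp : proj1 one (x : E) = x := hker x (by rw [hx0, inner_zero_left])
  have hp0 : proj1 one (x : E) = 0 :=
    proj1_eq_zero_of_inner _ _ (Submodule.mem_orthogonal_singleton_iff_inner_right.mp x.2)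
  have hx' : (x : E) = 0 := by rw [← hp, hp0]
  exact (Submodule.coe_eq_zero).mp hx'

omit [FiniteDimensional ℝ E] [FiniteDimensional ℝ F] in
/-- The printed clause «on the subspace orthogonal to constant functions the operator Δ is positive» (with Δ
symmetric, Δ1 = 0) gives the form used above: ⟨Δx, x⟩ = 0 forces x = π₁x (write x = (x − π₁x) + π₁x).
[cite: Balaban1984PropagatorsI, p.22] -/
theorem proj1_eq_self_of_form_eq_zero (hΔs : ∀ x y : E, inner ℝ (Δ x) y = inner ℝ x (Δ y)) (h1 : Δ one = 0)
    (hone : one ≠ 0) (hposK : ∀ x : E, inner ℝ one x = 0 → x ≠ 0 → 0 < inner ℝ (Δ x) x) (x : E)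
    (hx : inner ℝ (Δ x) x = 0) : proj1 one x = x := by
  have hΔy : Δ (x - proj1 one x) = Δ x := by
    rw [map_sub, proj1_apply, map_smul, h1, smul_zero, sub_zero]
  have hform : inner ℝ (Δ (x - proj1 one x)) (x - proj1 one x) = 0 := by
    rw [hΔy, inner_sub_right, hx, proj1_apply, real_inner_smul_right, hΔs, h1, inner_zero_right, mul_zero,
      sub_zero]
  by_contra hne
  have hne' : x - proj1 one x ≠ 0 := fun h0 => hne (sub_eq_zero.mp h0).symm
  exact (hposK _ (inner_one_sub_proj1 hone x) hne').ne' hform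

omit [FiniteDimensional ℝ F] in
/-- Δ⁻¹ := (Δ↾(1^⊥))⁻¹ ∘ (orthogonal projection onto 1^⊥) — «by Δ⁻¹ we denote its inverse on this subspace. We extend
it to the whole space by linearity, putting its value on constant functions equal to 0», CONSTRUCTED.
[cite: Balaban1984PropagatorsI, p.22] -/
def lapInv (hΔs : ∀ x y : E, inner ℝ (Δ x) y = inner ℝ x (Δ y)) (h1 : Δ one = 0)
    (hinj : Function.Injective (lapK hΔs h1)) : E →ₗ[ℝ] E :=
  ((ℝ ∙ one)ᗮ).subtype ∘ₗ (LinearEquiv.ofInjectiveEndo (lapK hΔs h1) hinj).symm.toLinearMap ∘ₗ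
    ((ℝ ∙ one)ᗮ).orthogonalProjectionOnto.toLinearMap

omit [FiniteDimensional ℝ F] in
/-- Unfolding of `lapInv`. [folklore] -/
theorem lapInv_apply (hΔs : ∀ x y : E, inner ℝ (Δ x) y = inner ℝ x (Δ y)) (h1 : Δ one = 0)
    (hinj : Function.Injective (lapK hΔs h1)) (u : E) :
    lapInv hΔs h1 hinj u = ((LinearEquiv.ofInjectiveEndo (lapK hΔs h1) hinj).symm
      (((ℝ ∙ one)ᗮ).orthogonalProjectionOnto u) : E) := rfl

omit [FiniteDimensional ℝ E] [FiniteDimensional ℝ F] in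
/-- The orthogonal projection onto the constants ℝ·1 is π₁ = `proj1`. [folklore] -/
theorem starProjection_span (hone : one ≠ 0) (u : E) : (ℝ ∙ one).starProjection u = proj1 one u := by
  apply Submodule.eq_starProjection_of_mem_of_inner_eq_zero
  · rw [proj1_apply]; exact Submodule.smul_mem _ _ (Submodule.mem_span_singleton_self one)
  · intro w hw
    obtain ⟨s, rfl⟩ := Submodule.mem_span_singleton.mp hw
    rw [real_inner_smul_right, real_inner_comm one (u - proj1 one u), inner_one_sub_proj1 hone u, mul_zero]

omit [FiniteDimensional ℝ E] [FiniteDimensional ℝ F] in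
/-- The orthogonal projection onto 1^⊥ is I − π₁. [folklore] -/
theorem coe_orthProj (hone : one ≠ 0) (u : E) :
    (((ℝ ∙ one)ᗮ).orthogonalProjectionOnto u : E) = u - proj1 one u := by
  rw [Submodule.coe_orthogonalProjectionOnto_apply, Submodule.starProjection_orthogonal_val,
    starProjection_span hone]

omit [FiniteDimensional ℝ F] in
/-- ΔΔ⁻¹ = I − π₁ (`LapData.lap_inv`) for the constructed Δ⁻¹. [cite: Balaban1984PropagatorsI, p.22] -/
theorem lap_lapInv (hΔs : ∀ x y : E, inner ℝ (Δ x) y = inner ℝ x (Δ y)) (h1 : Δ one = 0)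
    (hinj : Function.Injective (lapK hΔs h1)) (hone : one ≠ 0) (u : E) :
    Δ (lapInv hΔs h1 hinj u) = u - proj1 one u := by
  rw [lapInv_apply, ← coe_lapK_apply hΔs h1, ← coe_orthProj hone u]
  congr 1
  have h := (LinearEquiv.ofInjectiveEndo _ hinj).apply_symm_apply (((ℝ ∙ one)ᗮ).orthogonalProjectionOnto u)
  rwa [LinearEquiv.coe_ofInjectiveEndo] at h

omit [FiniteDimensional ℝ F] in
/-- Δ⁻¹Δ = I − π₁ (`LapData.inv_lap`) for the constructed Δ⁻¹. [cite: Balaban1984PropagatorsI, p.22] -/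
theorem lapInv_lap (hΔs : ∀ x y : E, inner ℝ (Δ x) y = inner ℝ x (Δ y)) (h1 : Δ one = 0)
    (hinj : Function.Injective (lapK hΔs h1)) (hone : one ≠ 0) (x : E) :
    lapInv hΔs h1 hinj (Δ x) = x - proj1 one x := by
  have hmem : x - proj1 one x ∈ (ℝ ∙ one)ᗮ :=
    Submodule.mem_orthogonal_singleton_iff_inner_right.mpr (inner_one_sub_proj1 hone x)
  have hP : ((ℝ ∙ one)ᗮ).orthogonalProjectionOnto (Δ x) = ⟨Δ x, lap_mem_orth hΔs h1 x⟩ :=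
    Submodule.orthogonalProjectionOnto_mem_subspace_eq_self (⟨Δ x, lap_mem_orth hΔs h1 x⟩ : (ℝ ∙ one)ᗮ)
  have hK : lapK hΔs h1 ⟨x - proj1 one x, hmem⟩ = ⟨Δ x, lap_mem_orth hΔs h1 x⟩ := by
    apply Subtype.ext
    simp only [coe_lapK_apply, map_sub, proj1_apply, map_smul, h1, smul_zero, sub_zero]
  have hs : (LinearEquiv.ofInjectiveEndo _ hinj).symm ⟨Δ x, lap_mem_orth hΔs h1 x⟩ = ⟨x - proj1 one x, hmem⟩ := by
    rw [LinearEquiv.symm_apply_eq, LinearEquiv.coe_ofInjectiveEndo]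
    exact hK.symm
  rw [lapInv_apply, hP, hs]

omit [FiniteDimensional ℝ F] in
/-- Δ⁻¹1 = 0 (`LapData.inv_one`) for the constructed Δ⁻¹: «putting its value on constant functions equal to 0».
[cite: Balaban1984PropagatorsI, p.22] -/
theorem lapInv_one (hΔs : ∀ x y : E, inner ℝ (Δ x) y = inner ℝ x (Δ y)) (h1 : Δ one = 0)
    (hinj : Function.Injective (lapK hΔs h1)) : lapInv hΔs h1 hinj one = 0 := by
  rw [lapInv_apply, Submodule.orthogonalProjectionOnto_apply_of_mem_orthogonal
    (Submodule.le_orthogonal_orthogonal _ (Submodule.mem_span_singleton_self one)), map_zero]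
  rfl

omit [FiniteDimensional ℝ F] in
/-- **Reader A's `LapData` is INHABITED by the constructed Δ⁻¹.** [cite: Balaban1984PropagatorsI, p.22] -/
theorem lapData (hΔs : ∀ x y : E, inner ℝ (Δ x) y = inner ℝ x (Δ y)) (h1 : Δ one = 0)
    (hinj : Function.Injective (lapK hΔs h1)) (hone : one ≠ 0) : LapData one Δ (lapInv hΔs h1 hinj) :=
  ⟨hΔs, h1, lap_lapInv hΔs h1 hinj hone, lapInv_lap hΔs h1 hinj hone, lapInv_one hΔs h1 hinj⟩

omit [FiniteDimensional ℝ F] in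
/-- p. 22 from the structural facts alone: Δ symmetric with Δ1 = 0 and null vectors = constants ⟹ Δ⁻¹ with
ΔΔ⁻¹ = Δ⁻¹Δ = I − π₁, Δ⁻¹1 = 0 EXISTS. [cite: Balaban1984PropagatorsI, p.22] -/
theorem exists_lapData (hΔs : ∀ x y : E, inner ℝ (Δ x) y = inner ℝ x (Δ y)) (h1 : Δ one = 0)
    (hker : ∀ x : E, inner ℝ (Δ x) x = 0 → proj1 one x = x) (hone : one ≠ 0) :
    ∃ Δi : E →ₗ[ℝ] E, LapData one Δ Δi :=
  ⟨_, lapData hΔs h1 (lapK_injective hΔs h1 hker) hone⟩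

/-! ## §4 Q′_k* as the adjoint -/

/-- With Q′_k* := the adjoint of Q′_k (`LinearMap.adjoint`, finite dimension) reader A's `AvgData` holds as soon as
Q′_k1 = 1′ and Q′_k maps 1^⊥ into 1′^⊥ (p. 22). [cite: Balaban1984PropagatorsI, (1.20) p.20, p.22] -/
theorem avgData_adjoint (hq1 : q one = one')
    (hperp : ∀ x : E, inner ℝ one x = 0 → inner ℝ one' (q x) = 0) :
    AvgData one one' q (LinearMap.adjoint q) :=
  ⟨fun x φ => (LinearMap.adjoint_inner_right q x φ).symm, hq1, hperp⟩

/-- … and any `qs` adjoint to `q` in the sense of `AvgData.adj` IS that adjoint. [folklore] -/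
theorem qs_eq_adjoint (hadj : ∀ (x : E) (φ : F), inner ℝ (q x) φ = inner ℝ x (qs φ)) :
    qs = LinearMap.adjoint q :=
  (LinearMap.eq_adjoint_iff qs q).mpr (adj_symm hadj)

/-! ## §5 Consequence: the orthogonal projection onto ΔN(Q′_k) IS (1.44) with CONSTRUCTED G′_k, (Q′_kG′_k²Q′_k*)⁻¹ -/

/-- `B5GaussSectCR144.Rop_eq_R144` for the constructed operators: the orthogonal projection onto ΔN(Q′_k) equals
R = I − G′_kQ′_k*(Q′_kG′_k²Q′_k*)⁻¹Q′_kG′_k (1.44) with G′_k = `green`, (Q′_kG′_k²Q′_k*)⁻¹ = `cinv`.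
[cite: Balaban1984PropagatorsI, (1.44)+p.25 ll.2-5] -/
theorem Rop_eq_R144_constructed (h : Function.Injective (lapPrime Δ q qs a))
    (hc : Function.Injective (qggq h)) (hΔs : ∀ x y : E, inner ℝ (Δ x) y = inner ℝ x (Δ y))
    (hadj : ∀ (x : E) (φ : F), inner ℝ (q x) φ = inner ℝ x (qs φ)) (f : E) :
    Rop (LinearMap.ker q) Δ f = R144 q qs (green h) (cinv h hc) f :=
  Rop_eq_R144 (greenData h hc) hΔs hadj f

/-- From the printed structural facts alone: there EXIST G′_k, (Q′_kG′_k²Q′_k*)⁻¹ satisfying `GreenData` for which the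
printed (1.44) is the orthogonal projection onto ΔN(Q′_k) on every f ∈ L²(T_η).
[cite: Balaban1984PropagatorsI, (1.44)+p.25] -/
theorem exists_green_Rop_eq_R144 (hpos : ∀ x : E, 0 ≤ inner ℝ (Δ x) x)
    (hker : ∀ x : E, inner ℝ (Δ x) x = 0 → proj1 one x = x)
    (hΔs : ∀ x y : E, inner ℝ (Δ x) y = inner ℝ x (Δ y))
    (hadj : ∀ (x : E) (φ : F), inner ℝ (q x) φ = inner ℝ x (qs φ)) (hq1 : q one = one')
    (hone' : one' ≠ 0) (hqs : Function.Injective qs) (ha : 0 < a) :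
    ∃ (g : E →ₗ[ℝ] E) (c₂ : F →ₗ[ℝ] F), GreenData Δ q qs a g c₂ ∧
      ∀ f : E, Rop (LinearMap.ker q) Δ f = R144 q qs g c₂ f :=
  have h := lapPrime_injective hpos hker hadj hq1 hone' ha
  have hc := qggq_injective h hΔs hadj hqs
  ⟨green h, cinv h hc, greenData h hc, Rop_eq_R144_constructed h hc hΔs hadj⟩

/-! ## §6 p. 22: the inverse (Q′_kΔ⁻²Q′_k*)⁻¹ of (1.38) on the subspace 1′^⊥ -/

variable {Δi : E →ₗ[ℝ] E}

omit [FiniteDimensional ℝ E] [FiniteDimensional ℝ F] in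
/-- Ran Q′_kΔ⁻²Q′_k* ⊆ 1′^⊥ (Δ⁻¹ maps into 1^⊥, Q′_k maps 1^⊥ into 1′^⊥). [folklore] -/
theorem qiiq_mem_orth (hΔ : LapData one Δ Δi) (hQ : AvgData one one' q qs) (hone : one ≠ 0) (φ : F) :
    q (Δi (Δi (qs φ))) ∈ (ℝ ∙ one')ᗮ :=
  Submodule.mem_orthogonal_singleton_iff_inner_right.mpr (hQ.perp _ (hΔ.inner_one_inv hone _))

omit [FiniteDimensional ℝ E] [FiniteDimensional ℝ F] in
/-- Q′_kΔ⁻²Q′_k* restricted to 1′^⊥, as an endomorphism of 1′^⊥. [folklore] -/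
def qiiqK (hΔ : LapData one Δ Δi) (hQ : AvgData one one' q qs) (hone : one ≠ 0) :
    (ℝ ∙ one')ᗮ →ₗ[ℝ] (ℝ ∙ one')ᗮ :=
  LinearMap.codRestrict ((ℝ ∙ one')ᗮ) ((q ∘ₗ Δi ∘ₗ Δi ∘ₗ qs).domRestrict ((ℝ ∙ one')ᗮ))
    fun φ => qiiq_mem_orth hΔ hQ hone φ

omit [FiniteDimensional ℝ E] [FiniteDimensional ℝ F] in
/-- Unfolding of `qiiqK`. [folklore] -/
theorem coe_qiiqK_apply (hΔ : LapData one Δ Δi) (hQ : AvgData one one' q qs) (hone : one ≠ 0)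
    (φ : (ℝ ∙ one')ᗮ) : (qiiqK hΔ hQ hone φ : F) = q (Δi (Δi (qs φ))) := rfl

omit [FiniteDimensional ℝ E] [FiniteDimensional ℝ F] in
/-- ⟨Q′_kΔ⁻²Q′_k*φ, φ⟩ = ‖Δ⁻¹Q′_k*φ‖². [folklore] -/
theorem inner_qiiq (hΔ : LapData one Δ Δi) (hQ : AvgData one one' q qs) (φ : F) :
    inner ℝ (q (Δi (Δi (qs φ)))) φ = ‖Δi (qs φ)‖ ^ 2 := by
  rw [hQ.adj, hΔ.inv_symm, real_inner_self_eq_norm_sq]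

omit [FiniteDimensional ℝ E] [FiniteDimensional ℝ F] in
/-- Δ⁻¹Q′_k*φ = 0 with φ ⊥ 1′ forces Q′_k*φ = 0 (apply Δ: Q′_k*φ = π₁Q′_k*φ = (⟨1′, φ⟩/⟨1, 1⟩)1 = 0). [folklore] -/
theorem qs_eq_zero_of_inv (hΔ : LapData one Δ Δi) (hQ : AvgData one one' q qs) {φ : F}
    (hφ : inner ℝ one' φ = 0) (h0 : Δi (qs φ) = 0) : qs φ = 0 := by
  have h := hΔ.lap_inv (qs φ)
  rw [h0, map_zero, proj1_apply, hQ.inner_one_qs, hφ, zero_div, zero_smul, sub_zero] at h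
  exact h.symm

omit [FiniteDimensional ℝ E] [FiniteDimensional ℝ F] in
/-- «The operator Δ⁻² is positive on the subspace orthogonal to constant functions, hence Q′_kΔ⁻²Q′_k* is positive
also on the corresponding subspace on the unit lattice» (Q′_k* injective). [cite: Balaban1984PropagatorsI, p.22] -/
theorem qiiq_pos (hΔ : LapData one Δ Δi) (hQ : AvgData one one' q qs) (hqs : Function.Injective qs) {φ : F}
    (hφ : inner ℝ one' φ = 0) (hne : φ ≠ 0) : 0 < inner ℝ (q (Δi (Δi (qs φ)))) φ := by
  rw [inner_qiiq hΔ hQ]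
  have hne' : Δi (qs φ) ≠ 0 := fun h0 => hne (hqs (by rw [qs_eq_zero_of_inv hΔ hQ hφ h0, map_zero]))
  exact pow_pos (norm_pos_iff.mpr hne') 2

omit [FiniteDimensional ℝ E] [FiniteDimensional ℝ F] in
/-- Q′_kΔ⁻²Q′_k*↾(1′^⊥) is INJECTIVE (Q′_k* injective). [cite: Balaban1984PropagatorsI, p.22] -/
theorem qiiqK_injective (hΔ : LapData one Δ Δi) (hQ : AvgData one one' q qs) (hone : one ≠ 0)
    (hqs : Function.Injective qs) : Function.Injective (qiiqK hΔ hQ hone) := by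
  rw [injective_iff_map_eq_zero]
  intro φ hφ
  have hφ1 : inner ℝ one' (φ : F) = 0 := Submodule.mem_orthogonal_singleton_iff_inner_right.mp φ.2
  have hq0 : q (Δi (Δi (qs (φ : F)))) = 0 := by rw [← coe_qiiqK_apply hΔ hQ hone φ, hφ]; rfl
  have h0 : ‖Δi (qs (φ : F))‖ ^ 2 = 0 := by rw [← inner_qiiq hΔ hQ, hq0, inner_zero_left]
  have h1 : Δi (qs (φ : F)) = 0 := norm_eq_zero.mp ((pow_eq_zero_iff two_ne_zero).mp h0)
  have h2 : qs (φ : F) = 0 := qs_eq_zero_of_inv hΔ hQ hφ1 h1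
  have h3 : (φ : F) = 0 := hqs (by rw [h2, map_zero])
  exact (Submodule.coe_eq_zero).mp h3

omit [FiniteDimensional ℝ E] in
/-- (Q′_kΔ⁻²Q′_k*)⁻¹ := (Q′_kΔ⁻²Q′_k*↾(1′^⊥))⁻¹ ∘ (orthogonal projection onto 1′^⊥), CONSTRUCTED — the inverse «on the
corresponding subspace on the unit lattice» of p. 22, used in (1.37)/(1.38). [cite: Balaban1984PropagatorsI, p.22] -/
def cinv138 (hΔ : LapData one Δ Δi) (hQ : AvgData one one' q qs) (hone : one ≠ 0)
    (hinj : Function.Injective (qiiqK hΔ hQ hone)) : F →ₗ[ℝ] F :=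
  ((ℝ ∙ one')ᗮ).subtype ∘ₗ (LinearEquiv.ofInjectiveEndo (qiiqK hΔ hQ hone) hinj).symm.toLinearMap ∘ₗ
    ((ℝ ∙ one')ᗮ).orthogonalProjectionOnto.toLinearMap

omit [FiniteDimensional ℝ E] in
/-- Unfolding of `cinv138`. [folklore] -/
theorem cinv138_apply (hΔ : LapData one Δ Δi) (hQ : AvgData one one' q qs) (hone : one ≠ 0)
    (hinj : Function.Injective (qiiqK hΔ hQ hone)) (φ : F) :
    cinv138 hΔ hQ hone hinj φ = ((LinearEquiv.ofInjectiveEndo (qiiqK hΔ hQ hone) hinj).symm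
      (((ℝ ∙ one')ᗮ).orthogonalProjectionOnto φ) : F) := rfl

omit [FiniteDimensional ℝ E] in
/-- **Reader A's clause `hci` is INHABITED:** (Q′_kΔ⁻²Q′_k*)(Q′_kΔ⁻²Q′_k*)⁻¹φ = φ for φ ⊥ 1′.
[cite: Balaban1984PropagatorsI, p.22] -/
theorem cinv138_spec (hΔ : LapData one Δ Δi) (hQ : AvgData one one' q qs) (hone : one ≠ 0)
    (hinj : Function.Injective (qiiqK hΔ hQ hone)) (φ : F) (hφ : inner ℝ one' φ = 0) :
    q (Δi (Δi (qs (cinv138 hΔ hQ hone hinj φ)))) = φ := by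
  have hmem : φ ∈ (ℝ ∙ one')ᗮ := Submodule.mem_orthogonal_singleton_iff_inner_right.mpr hφ
  have hP : ((ℝ ∙ one')ᗮ).orthogonalProjectionOnto φ = ⟨φ, hmem⟩ :=
    Submodule.orthogonalProjectionOnto_mem_subspace_eq_self (⟨φ, hmem⟩ : (ℝ ∙ one')ᗮ)
  have h := (LinearEquiv.ofInjectiveEndo _ hinj).apply_symm_apply (⟨φ, hmem⟩ : (ℝ ∙ one')ᗮ)
  rw [LinearEquiv.coe_ofInjectiveEndo] at h
  have h' := congrArg Subtype.val h
  rw [coe_qiiqK_apply] at h'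
  rw [cinv138_apply, hP]
  exact h'

omit [FiniteDimensional ℝ E] in
/-- p. 22 from the structural facts alone: given Δ⁻¹ (`LapData`), Q′_k/Q′_k* (`AvgData`), 1 ≠ 0 and Q′_k* injective,
the inverse (Q′_kΔ⁻²Q′_k*)⁻¹ on 1′^⊥ EXISTS. [cite: Balaban1984PropagatorsI, p.22] -/
theorem exists_ci (hΔ : LapData one Δ Δi) (hQ : AvgData one one' q qs) (hone : one ≠ 0)
    (hqs : Function.Injective qs) :
    ∃ ci : F →ₗ[ℝ] F, ∀ φ : F, inner ℝ one' φ = 0 → q (Δi (Δi (qs (ci φ)))) = φ :=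
  ⟨_, cinv138_spec hΔ hQ hone (qiiqK_injective hΔ hQ hone hqs)⟩

/-! ## §7 Everything at once: reader A's whole hypothesis set realised from the printed structural facts -/

/-- **The p. 22 / p. 25 well-definedness statements together.** From the PRINTED structural facts — Δ symmetric,
non-negative, positive on 1^⊥, Δ1 = 0; Q′_k* adjoint to Q′_k, Q′_k1 = 1′ ≠ 0, Q′_k(1^⊥) ⊆ 1′^⊥, Q′_k* injective;
a > 0 — there EXIST Δ⁻¹, G′_k, (Q′_kG′_k²Q′_k*)⁻¹ and (Q′_kΔ⁻²Q′_k*)⁻¹ satisfying ALL of reader A's hypotheses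
(`LapData`, `AvgData`, `GreenData`, `hci`), and then the orthogonal projection onto ΔN(Q′_k) is (1.44) on L²(T_η)
and (1.38) on 1^⊥ (a NON-degenerate complement to `B5Projector144.hypotheses_satisfiable`).
[cite: Balaban1984PropagatorsI, p.22+p.25] -/
theorem exists_all_printed (hΔs : ∀ x y : E, inner ℝ (Δ x) y = inner ℝ x (Δ y))
    (hpos : ∀ x : E, 0 ≤ inner ℝ (Δ x) x)
    (hposK : ∀ x : E, inner ℝ one x = 0 → x ≠ 0 → 0 < inner ℝ (Δ x) x) (h1 : Δ one = 0)
    (hadj : ∀ (x : E) (φ : F), inner ℝ (q x) φ = inner ℝ x (qs φ)) (hq1 : q one = one')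
    (hperp : ∀ x : E, inner ℝ one x = 0 → inner ℝ one' (q x) = 0) (hone' : one' ≠ 0)
    (hqs : Function.Injective qs) (ha : 0 < a) :
    ∃ (Δi g : E →ₗ[ℝ] E) (c₂ ci : F →ₗ[ℝ] F), LapData one Δ Δi ∧ AvgData one one' q qs ∧
      GreenData Δ q qs a g c₂ ∧ (∀ φ : F, inner ℝ one' φ = 0 → q (Δi (Δi (qs (ci φ)))) = φ) ∧
      (∀ f : E, Rop (LinearMap.ker q) Δ f = R144 q qs g c₂ f) ∧
      ∀ f : E, inner ℝ one f = 0 → Rop (LinearMap.ker q) Δ f = R138 Δi q qs ci f := by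
  have hone : one ≠ 0 := by rintro rfl; exact hone' (by rw [← hq1, map_zero])
  have hker : ∀ x : E, inner ℝ (Δ x) x = 0 → proj1 one x = x :=
    proj1_eq_self_of_form_eq_zero hΔs h1 hone hposK
  have hQ : AvgData one one' q qs := ⟨hadj, hq1, hperp⟩
  have hΔ := lapData hΔs h1 (lapK_injective hΔs h1 hker) hone
  have h := lapPrime_injective hpos hker hadj hq1 hone' ha
  have hc := qggq_injective h hΔs hadj hqs
  have hci := cinv138_spec hΔ hQ hone (qiiqK_injective hΔ hQ hone hqs)
  exact ⟨_, green h, cinv h hc, _, hΔ, hQ, greenData h hc, hci, Rop_eq_R144_constructed h hc hΔs hadj,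
    fun f hf => Rop_eq_R138_of_orth hΔ hQ hone hone' hci (greenData h hc) f hf⟩

end Literature.MathematicalPhysics.QuantumFieldTheory.Balaban1983to89.B5Projector144Exists
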